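import Summits.BirchSwinnertonDyer.BirchSwinnertonDyer.Theorems.PublishedInputsGreenbergLemma34CocycleLemmas
import Summits.BirchSwinnertonDyer.BirchSwinnertonDyer.Theorems.ByReductionTypeAtTwoGoodOrdTowerControlKummerFixed
import HarnessLib

set_option linter.dupNamespace false -- `…BirchSwinnertonDyer.BirchSwinnertonDyer…` is the cell's nested layout (D-0017)
set_option autoImplicit false

/-!
# Greenberg LNM 1716 Lemma 3.4 at `n = 0`, step 2: the EXACT Kummer count for the formal group,
# `#(Ê(𝔪̄)^{H_∞}/(g − 1))[p^k] · #(Ê(𝔪)/p^k) = #H¹(Γ_{K_v}, Ê[p^k])`, from the Coates–Greenberg vanishing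

Seat `bsd-inputs-k4-p1` (gen 5; LADDER-BSD D-0154 KEY (147)(f) «prove the printed input», row 1 K4 INPUTS; Greenberg
1999), `--supports stmt-BirchSwinnertonDyer-20309`. THEOREMS ONLY (no definition, no named fact, no `sorry`).

R. Greenberg, *Iwasawa theory for elliptic curves*, LNM 1716 (1999), §2 Prop. 2.5 (p. 80) and §3 Lemma 3.4 (p. 89): the
factor `|ker(a_v)| = |Im λ_v / Im κ_v| = |H¹(F_v, 𝓕(𝔪̄))|` of `|ker(r_v)|`, where `𝓕` is the formal group; Prop. 2.5's proof is
the Kummer diagram for `𝓕(𝔪)` ("the upper row is the Kummer sequence for `𝓕(𝔪)`, based on the fact that `𝓕(𝔪̄)` is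
divisible"). In the tree's POINTS currency (`A₁ = ker red₀ = Ê(𝔪̄) ⊆ E(K̄_v)`, `M₁ = A₁^{H_∞}`, `D₁ = g − 1`,
`A₀ = A₁^{Γ}`), cell bsd-2adic's BRICK B2′ (`GoodOrdTower.natCard_torsionBy_coinv_mul_card_quotient_le_card_H1_of_fixed`)
is the INEQUALITY `#(M₁/D₁M₁)[p^k] · #(A₀/p^k A₀) ≤ #H¹(·, A₁[p^k])` (the evaluation map is only injective). Here, at the
layer `0` (the whole local Galois group `Γ = Γ_E`) and for ANY `ℤ_p`-extension `κE` of the local field `E` with kernel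
`N` and topological generator `g`:

* `natCard_torsionBy_coinv_mul_card_quotient_eq_card_H1` — **EQUALITY**
  `#(M₁/D₁M₁)[p^k] · #(A₀/p^k A₀) = #H¹(Γ, Z)` (`Z ≅ A₁[p^k]` equivariantly), GIVEN the Coates–Greenberg vanishing
  «every continuous `A₁`-valued cocycle on `N` is the coboundary of an element of `A₁`» (`hCG`; tree:
  `CoatesGreenberg1996_H1_formalGroup_trivial_holds` / `H1_goodModelKernel_trivial_holds`, PROVED at universe `0`).
  The new half is the SURJECTIVITY of `[x] ↦ [χ_x] mod κ(A₀)`: a class `[f] ∈ H¹(Γ, Z)`, pushed to `A₁`, restricts on `N`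
  to `∂e` (`hCG`); `f' = f − ∂e` vanishes on `N`, so `x = f'(g) ∈ M₁` with `p^k x = D₁(−p^k e)`, and `[χ_x] ≡ [f]`:
  two `A₁`-valued cocycles vanishing on `N` with the same value at `g` coincide (`N` and `g` generate `Γ` topologically).
  The inflation cocycles are those of the prequel (`ZpExtension.exists_cocycle_vanishing_apply_eq_of_nsmul_eq_sub`); their
  `A₁`-valuedness and the identity `p^k χ = ∂y` are read off the open subgroups `{σ : ψ σ ∈ A₁}`, `{σ : ψ σ = 0}`.

HONEST FRAMING: a local TOOL theorem with displayed hypotheses; closes nothing; no summit statement is proved; BSD is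
not proved by any of this. References: [GreenbergLNM1716] §2 Prop. 2.5 (p. 80), §3 Lemma 3.4 (p. 89);
[SerreLocalFields1979] XIII §1; [CoatesGreenberg1996] Cor. 3.2. -/

noncomputable section

open scoped Classical

universe u

namespace Summit.BirchSwinnertonDyer.BirchSwinnertonDyer.Theorems.InputsGreenbergLemma34

open Field Literature.NumberTheory.EllipticCurves Literature.NumberTheory.GaloisRepresentations
  Literature.NumberTheory.EllipticCurves.ZpExtension _root_.ContinuousCohomology WeierstrassCurve

variable {K : Type u} [Field K] (W : WeierstrassCurve K) (E : Type u) [Field E] [CharZero E] [Algebra K E]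
  {p : ℕ} [hp : Fact p.Prime]

set_option maxHeartbeats 1600000 in
/-- **The EXACT Kummer count for the formal group at the layer `0`: `#(M₁/D₁M₁)[p^k] · #(A₀/p^k A₀) = #H¹(Γ_E, Z)`.**
Setting: `E` a field of characteristic `0` over `K`, `W/K` a Weierstrass curve, `κE` a `ℤ_p`-extension of `E` with
kernel `N` and topological generator `g`, `Γ = Γ_E`; `A₁ ⊆ E(K̄_E)` a `Γ`-stable, `p^k`-divisible subgroup («`Ê(𝔪̄)`»);
`Z` a discrete `Γ`-module with an injective equivariant `ιZ : Z → E(K̄_E)` onto `A₁[p^k]`; `M₁ = A₁^N` with `D₁ = g − 1`,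
`A₀ = A₁^Γ`; and (`hCG`) every continuous `A₁`-valued cocycle of `N` is `∂e`, `e ∈ A₁`. If `H¹(Γ, Z)` is finite then
`(M₁/D₁M₁)[p^k]` and `A₀/p^k A₀` are finite and `#(M₁/D₁M₁)[p^k] · #(A₀/p^k A₀) = #H¹(Γ, Z)`. The map
`[x] ↦ [χ_x] mod κ(A₀)` (`χ_x = c_x − ∂ỹ`, `c_x` the inflation cocycle with `c_x(g) = x`, `p^k c_x = ∂y`, `p^k ỹ = y`) is
injective exactly as in bsd-2adic's BRICK B2′ (whose cocycle bookkeeping is reproduced), and surjective by `hCG` (module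
docstring). [cite: GreenbergLNM1716, §2 Prop. 2.5 (p. 80) and §3 Lemma 3.4 (p. 89)] [cite: SerreLocalFields1979, XIII §1 Prop. 1]
[cite: CoatesGreenberg1996, Cor. 3.2] -/
theorem natCard_torsionBy_coinv_mul_card_quotient_eq_card_H1 (κE : ZpExtension E p)
    {g : absoluteGaloisGroup E} (hγ : κE.IsTopGenerator g) (k : ℕ)
    (A₁ : AddSubgroup (localPoints W E))
    (hstab : ∀ (σ : absoluteGaloisGroup E) (a : localPoints W E), a ∈ A₁ → σ • a ∈ A₁)
    (hdivk : ∀ a ∈ A₁, ∃ b ∈ A₁, p ^ k • b = a)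
    {Z : Type u} [AddCommGroup Z] [DistribMulAction (absoluteGaloisGroup E) Z]
    [TopologicalSpace Z] [DiscreteTopology Z]
    (ιZ : Z →+ localPoints W E) (hιZ : Function.Injective ιZ)
    (hZr : ∀ a : localPoints W E, a ∈ A₁ ∧ p ^ k • a = 0 ↔ a ∈ ιZ.range)
    (hιeq : ∀ (σ : absoluteGaloisGroup E) (z : Z), ιZ (σ • z) = σ • ιZ z)
    (M₁ : AddSubgroup (localPoints W E))
    (hM₁ : ∀ a, a ∈ M₁ ↔ a ∈ A₁ ∧ ∀ h ∈ κE.kerSubgroup, h • a = a)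
    (D₁ : M₁ →+ M₁) (hD₁ : ∀ a : M₁, ((D₁ a : M₁) : localPoints W E) = g • (a : _) - a)
    (A₀ : AddSubgroup (localPoints W E))
    (hA₀ : ∀ a, a ∈ A₀ ↔ a ∈ A₁ ∧ ∀ σ : absoluteGaloisGroup E, σ • a = a)
    (hCG : ∀ ψ : contOneCocycles (discreteTopRep κE.kerSubgroup (localPoints W E)),
      (∀ τ, ψ.1 τ ∈ A₁) → ∃ e ∈ A₁, ∀ τ : κE.kerSubgroup, ψ.1 τ = (τ : absoluteGaloisGroup E) • e - e)
    [Finite (discreteH1 (absoluteGaloisGroup E) Z)] :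
    Finite {c : M₁ ⧸ D₁.range // p ^ k • c = 0} ∧
      Finite (A₀ ⧸ (nsmulAddMonoidHom (p ^ k) : A₀ →+ A₀).range) ∧
      Nat.card {c : M₁ ⧸ D₁.range // p ^ k • c = 0} *
          Nat.card (A₀ ⧸ (nsmulAddMonoidHom (p ^ k) : A₀ →+ A₀).range) =
        Nat.card (discreteH1 (absoluteGaloisGroup E) Z) := by
  -- adapted from Summits/.../Theorems/ByReductionTypeAtTwoGoodOrdTowerControlKummerFixed.lean (cell bsd-2adic, BRICK B2′)
  -- notation
  let P : Type u := localPoints W E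
  let Γ := absoluteGaloisGroup E
  let N : Subgroup Γ := κE.kerSubgroup
  let X : _root_.TopRep ℤ Γ := discreteTopRep Γ Z
  have hXρ : ∀ (σ : Γ) (z : Z), X.ρ σ z = σ • z := fun _ _ ↦ rfl
  -- a left inverse of `ιZ`
  obtain ⟨linv, hlinv⟩ := hιZ.hasLeftInverse
  have hιlinv : ∀ a : P, a ∈ A₁ → p ^ k • a = 0 → ιZ (linv a) = a := fun a ha hpa ↦ by
    obtain ⟨z, rfl⟩ := (hZr a).mp ⟨ha, hpa⟩
    rw [hlinv z]
  have hιA : ∀ z : Z, ιZ z ∈ A₁ := fun z ↦ ((hZr (ιZ z)).mpr ⟨z, rfl⟩).1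
  have hιp : ∀ z : Z, p ^ k • ιZ z = 0 := fun z ↦ ((hZr (ιZ z)).mpr ⟨z, rfl⟩).2
  -- a continuous `A₁[p^k]`-valued crossed homomorphism of `Γ` gives a continuous `1`-cocycle of `Z`
  have hmk : ∀ w : Γ → P, Continuous w → (∀ σ, w σ ∈ A₁ ∧ p ^ k • w σ = 0) →
      (∀ σ τ, w (σ * τ) = w σ + σ • w τ) → ∃ f : contOneCocycles X, ∀ σ, ιZ (f.1 σ) = w σ := by
    intro w hw hwZ hcoc
    have hcont : Continuous (linv ∘ w) := (((IsLocallyConstant.iff_continuous w).mpr hw).comp linv).continuous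
    refine ⟨⟨⟨linv ∘ w, hcont⟩, fun σ τ ↦ hιZ ?_⟩, fun σ ↦ hιlinv _ (hwZ σ).1 (hwZ σ).2⟩
    change ιZ (linv (w (σ * τ))) = ιZ (linv (w σ) + X.ρ σ (linv (w τ)))
    rw [map_add, hXρ, hιeq, hιlinv _ (hwZ _).1 (hwZ _).2, hιlinv _ (hwZ _).1 (hwZ _).2,
      hιlinv _ (hwZ _).1 (hwZ _).2, hcoc]
  -- classes: `[f] = [f']` as soon as `f - f'` is the coboundary of some `z`
  have hcls : ∀ (f f' : contOneCocycles X) (z : Z),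
      (∀ σ : Γ, ιZ (f.1 σ) - ιZ (f'.1 σ) = σ • ιZ z - ιZ z) → oneCocycleClass X f = oneCocycleClass X f' := by
    intro f f' z h
    rw [← sub_eq_zero, ← oneCocycleClass_sub, oneCocycleClass_eq_zero_iff]
    refine ⟨z, fun σ ↦ hιZ ?_⟩
    change ιZ (f.1 σ - f'.1 σ) = ιZ (X.ρ σ z - z)
    rw [map_sub, map_sub, hXρ, hιeq, h σ]
  -- coboundaries `σ ↦ σ t - t` of elements `t ∈ A₁` with `p^k t` fixed by `Γ`
  have hcob : ∀ t : P, t ∈ A₁ → (∀ σ : Γ, σ • (p ^ k • t) = p ^ k • t) →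
      ∃ f : contOneCocycles X, ∀ σ : Γ, ιZ (f.1 σ) = σ • t - t := by
    intro t ht hpt
    refine hmk _ ((continuous_smul_localPoints W E t).sub continuous_const)
      (fun σ ↦ ⟨A₁.sub_mem (hstab _ _ ht) ht, ?_⟩) (fun σ τ ↦ ?_)
    · rw [smul_sub, smul_comm, hpt σ, sub_self]
    · rw [mul_smul, smul_sub]; abel
  -- roots: `rt a ∈ A₁`, `p^k • rt a = a` for `a ∈ A₁`
  choose rt hrtA hrt using hdivk
  -- the root of `b ∈ A₀`
  have hA₀A : ∀ b : A₀, (b : P) ∈ A₁ := fun b ↦ ((hA₀ b).mp b.2).1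
  have hrtfix : ∀ (b : A₀) (σ : Γ), σ • (p ^ k • rt b (hA₀A b)) = p ^ k • rt b (hA₀A b) :=
    fun b σ ↦ by rw [hrt b (hA₀A b)]; exact ((hA₀ b).mp b.2).2 σ
  choose kc hkc using fun b : A₀ ↦ hcob _ (hrtA b (hA₀A b)) (hrtfix b)
  -- independence of the root, in `H¹`
  have hindep : ∀ (f f' : contOneCocycles X) (t t' : P), t ∈ A₁ → t' ∈ A₁ → p ^ k • t = p ^ k • t' →
      (∀ σ : Γ, ιZ (f.1 σ) = σ • t - t) → (∀ σ : Γ, ιZ (f'.1 σ) = σ • t' - t') →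
        oneCocycleClass X f = oneCocycleClass X f' := by
    intro f f' t t' ht ht' hp hf hf'
    obtain ⟨z, hz⟩ := (hZr (t - t')).mp ⟨A₁.sub_mem ht ht', by rw [smul_sub, hp, sub_self]⟩
    refine hcls f f' z fun σ ↦ ?_
    rw [hf, hf', hz, smul_sub]
    abel
  -- the Kummer map `kum : A₀ →+ H¹(Γ, Z)`, `b ↦ [σ ↦ σ b̃ - b̃]`
  let kum : A₀ →+ discreteH1 Γ Z :=
    { toFun := fun b ↦ oneCocycleClass X (kc b)
      map_zero' := by
        rw [← oneCocycleClass_zero X]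
        refine hindep _ _ (rt _ (hA₀A 0)) 0 (hrtA _ _) A₁.zero_mem (by rw [hrt, smul_zero]; rfl) (hkc 0)
          fun σ ↦ ?_
        rw [smul_zero, sub_zero]
        exact map_zero ιZ
      map_add' := fun b b' ↦ by
        rw [← oneCocycleClass_add]
        refine hindep _ _ (rt _ (hA₀A (b + b'))) (rt b (hA₀A b) + rt b' (hA₀A b')) (hrtA _ _)
          (A₁.add_mem (hrtA _ _) (hrtA _ _)) (by rw [hrt, smul_add, hrt, hrt]; rfl) (hkc (b + b')) fun σ ↦ ?_
        change ιZ ((kc b).1 σ + (kc b').1 σ) = _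
        rw [map_add, hkc, hkc, smul_add]
        abel }
  have hkum : ∀ b : A₀, kum b = oneCocycleClass X (kc b) := fun _ ↦ rfl
  -- `ker kum = p^k A₀`
  have hker : kum.ker = (nsmulAddMonoidHom (p ^ k) : A₀ →+ A₀).range := by
    ext b
    rw [AddMonoidHom.mem_ker, AddMonoidHom.mem_range, hkum]
    constructor
    · intro hb
      obtain ⟨z, hz⟩ := (oneCocycleClass_eq_zero_iff X (kc b)).mp hb
      have hfix : ∀ σ : Γ, σ • (rt b (hA₀A b) - ιZ z) = rt b (hA₀A b) - ιZ z := by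
        intro σ
        have h := congrArg ιZ (hz σ)
        rw [hkc, hXρ, map_sub, hιeq] at h
        rw [smul_sub, sub_eq_sub_iff_sub_eq_sub, h]
      refine ⟨⟨rt b (hA₀A b) - ιZ z, (hA₀ _).mpr ⟨A₁.sub_mem (hrtA _ _) (hιA z), hfix⟩⟩, Subtype.ext ?_⟩
      change p ^ k • (rt b (hA₀A b) - ιZ z) = b
      rw [smul_sub, hrt, hιp, sub_zero]
    · rintro ⟨a, rfl⟩
      rw [← oneCocycleClass_zero X]
      refine hindep _ _ (rt _ (hA₀A ((nsmulAddMonoidHom (p ^ k) : A₀ →+ A₀) a))) (a : P) (hrtA _ _) (hA₀A a)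
        (by rw [hrt]; rfl) (hkc _) fun σ ↦ ?_
      rw [((hA₀ a).mp a.2).2 σ, sub_self]
      exact map_zero ιZ
  -- `#(A₀/p^kA₀) = #range kum`
  have hcardK : Nat.card (A₀ ⧸ (nsmulAddMonoidHom (p ^ k) : A₀ →+ A₀).range) = Nat.card kum.range := by
    rw [← hker]
    exact Nat.card_congr (QuotientAddGroup.quotientKerEquivRange kum).toEquiv
  haveI hKfin : Finite kum.range := inferInstance
  -- `M₁`
  have hM₁A : ∀ x : M₁, (x : P) ∈ A₁ := fun x ↦ ((hM₁ x).mp x.2).1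
  have hM₁i : ∀ x : M₁, ∀ h ∈ N, h • (x : P) = x := fun x ↦ ((hM₁ x).mp x.2).2
  -- representatives and the relation `p^k x = g y - y`
  have hrep : ∀ c : {c : M₁ ⧸ D₁.range // p ^ k • c = 0}, ∃ x y : M₁,
      (QuotientAddGroup.mk x : M₁ ⧸ D₁.range) = c.1 ∧ p ^ k • (x : P) = g • (y : P) - y := by
    intro c
    obtain ⟨x, hx⟩ := QuotientAddGroup.mk_surjective c.1
    have hpx : (QuotientAddGroup.mk (p ^ k • x) : M₁ ⧸ D₁.range) = 0 := by
      rw [QuotientAddGroup.mk_nsmul, hx]; exact c.2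
    rw [QuotientAddGroup.eq_zero_iff] at hpx
    obtain ⟨y, hy⟩ := hpx
    refine ⟨x, y, hx, ?_⟩
    rw [← hD₁ y, hy, AddSubgroup.coe_nsmul]
  choose xr yr hxr hrel using hrep
  -- the inflation cocycles (prequel), `A₁`-valued with `p^k cc = ∂y`
  have hcoc : ∀ c : {c : M₁ ⧸ D₁.range // p ^ k • c = 0}, ∃ cc : contOneCocycles (discreteTopRep Γ P),
      (∀ σ : Γ, σ ∈ N → cc.1 σ = 0) ∧ cc.1 g = (xr c : P) ∧ (∀ σ : Γ, cc.1 σ ∈ A₁) ∧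
      (∀ σ : Γ, p ^ k • cc.1 σ = σ • (yr c : P) - yr c) := by
    intro c
    obtain ⟨ψ, hψN, hψg⟩ := κE.exists_cocycle_vanishing_apply_eq_of_nsmul_eq_sub hγ
      (continuous_smul_localPoints W E) (xr c : P) (hM₁i (xr c)) (hM₁i (yr c)) (hrel c)
    refine ⟨ψ, hψN, hψg, contOneCocycles_apply_mem_of_apply_mem W E κE hγ A₁ hstab ψ hψN
      (by rw [hψg]; exact hM₁A (xr c)), fun σ ↦ ?_⟩
    -- `p^k ψ − ∂y` vanishes on `N` and at `g`, hence everywhere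
    let d : contOneCocycles (discreteTopRep Γ P) :=
      ⟨⟨fun σ ↦ p ^ k • ψ.1 σ - (σ • (yr c : P) - yr c),
        ((continuous_const_smul _).comp ψ.1.continuous |>.sub
          ((continuous_smul_localPoints W E _).sub continuous_const))⟩, fun σ τ ↦ by
        have h := ψ.2 σ τ
        change ψ.1 (σ * τ) = ψ.1 σ + σ • ψ.1 τ at h
        change p ^ k • ψ.1 (σ * τ) - ((σ * τ) • (yr c : P) - yr c) =
          (p ^ k • ψ.1 σ - (σ • (yr c : P) - yr c)) + σ • (p ^ k • ψ.1 τ - (τ • (yr c : P) - yr c))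
        rw [h, smul_add, mul_smul, smul_sub σ, smul_sub σ, smul_comm σ (p ^ k)]
        abel⟩
    have hd : ∀ σ : Γ, d.1 σ = p ^ k • ψ.1 σ - (σ • (yr c : P) - yr c) := fun _ ↦ rfl
    have hd0 := contOneCocycles_eq_zero_of_apply_eq_zero E κE hγ d
      (fun τ hτ ↦ by rw [hd, hψN τ hτ, smul_zero, hM₁i (yr c) τ hτ, sub_self, sub_zero])
      (by rw [hd, hψg, hrel c, sub_self]) σ
    rw [hd, sub_eq_zero] at hd0
    exact hd0
  choose cc hcc0 hccγ hccA hccp using hcoc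
  -- `χ_c = cc - ∂ỹ` with `ỹ = rt y`: a continuous `A₁[p^k]`-valued crossed homomorphism of `Γ`
  have hchi : ∀ c : {c : M₁ ⧸ D₁.range // p ^ k • c = 0}, ∃ f : contOneCocycles X, ∀ σ : Γ,
      ιZ (f.1 σ) = (cc c).1 σ - (σ • rt (yr c : P) (hM₁A (yr c)) - rt (yr c : P) (hM₁A (yr c))) := by
    intro c
    refine hmk _ (((cc c).1.continuous).sub ((continuous_smul_localPoints W E _).sub continuous_const))
      (fun σ ↦ ⟨A₁.sub_mem (hccA c σ) (A₁.sub_mem (hstab _ _ (hrtA _ _)) (hrtA _ _)), ?_⟩) (fun σ τ ↦ ?_)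
    · rw [smul_sub, hccp c σ, smul_sub, smul_comm, hrt, sub_self]
    · have h1 := (cc c).2 σ τ
      change (cc c).1 (σ * τ) = (cc c).1 σ + σ • (cc c).1 τ at h1
      rw [h1, mul_smul, smul_sub, smul_sub]
      abel
  choose chi hchi_apply using hchi
  -- `Φ c = [χ_c] mod range kum` is injective (bsd-2adic) ...
  let Φ : {c : M₁ ⧸ D₁.range // p ^ k • c = 0} → discreteH1 Γ Z ⧸ kum.range :=
    fun c ↦ QuotientAddGroup.mk (oneCocycleClass X (chi c))
  have hΦ : Function.Injective Φ := by
    intro c c' hcc'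
    have hmem : oneCocycleClass X (chi c) - oneCocycleClass X (chi c') ∈ kum.range := by
      rw [← QuotientAddGroup.eq_iff_sub_mem]
      exact hcc'
    obtain ⟨b, hb⟩ := hmem
    rw [hkum, ← oneCocycleClass_sub, eq_comm, ← sub_eq_zero, ← oneCocycleClass_sub, oneCocycleClass_eq_zero_iff] at hb
    obtain ⟨z, hz⟩ := hb
    have hval : ∀ σ : Γ, ((cc c).1 σ - (σ • rt (yr c : P) (hM₁A (yr c)) - rt (yr c : P) (hM₁A (yr c)))) -
        ((cc c').1 σ - (σ • rt (yr c' : P) (hM₁A (yr c')) - rt (yr c' : P) (hM₁A (yr c')))) -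
          (σ • rt b (hA₀A b) - rt b (hA₀A b)) = σ • ιZ z - ιZ z := by
      intro σ
      have h := congrArg ιZ (hz σ)
      change ιZ ((chi c).1 σ - (chi c').1 σ - (kc b).1 σ) = ιZ (X.ρ σ z - z) at h
      rw [map_sub, map_sub, map_sub, hchi_apply, hchi_apply, hkc, hXρ, hιeq] at h
      exact h
    set a : P := rt (yr c' : P) (hM₁A (yr c')) - rt (yr c : P) (hM₁A (yr c)) - rt b (hA₀A b) - ιZ z with ha_def
    have haA : a ∈ A₁ := A₁.sub_mem (A₁.sub_mem (A₁.sub_mem (hrtA _ _) (hrtA _ _)) (hrtA _ _)) (hιA z)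
    have hafix : ∀ h ∈ N, h • a = a := by
      intro h hh
      have e := hval h
      rw [hcc0 c h hh, hcc0 c' h hh, zero_sub, zero_sub] at e
      rw [ha_def, smul_sub, smul_sub, smul_sub]
      have e' := sub_eq_zero.mpr e
      rw [← sub_eq_zero, ← e']
      abel
    have haM : a ∈ M₁ := (hM₁ a).mpr ⟨haA, hafix⟩
    have eγ := hval g
    rw [hccγ c, hccγ c'] at eγ
    have hxx : (xr c : P) - xr c' = g • (-a) - (-a) := by
      have e' := sub_eq_zero.mpr eγ
      rw [← sub_eq_zero, ← e', ha_def]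
      simp only [smul_sub, smul_neg]
      abel
    have hD : xr c - xr c' = D₁ ⟨-a, M₁.neg_mem haM⟩ := by
      refine Subtype.ext ?_
      rw [AddSubgroup.coe_sub, hD₁]
      exact hxx
    apply Subtype.ext
    rw [← hxr c, ← hxr c', QuotientAddGroup.eq_iff_sub_mem, hD]
    exact ⟨_, rfl⟩
  -- ... and SURJECTIVE, by the Coates–Greenberg vanishing
  have hΦsurj : Function.Surjective Φ := by
    intro q
    obtain ⟨ξ, rfl⟩ := QuotientAddGroup.mk_surjective q
    obtain ⟨f, rfl⟩ := oneCocycleClass_surjective X ξ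
    -- `ιZ ∘ f` restricted to `N` is `∂e`, `e ∈ A₁`
    let fN : contOneCocycles (discreteTopRep N P) :=
      ⟨⟨fun τ ↦ ιZ (f.1 (τ : Γ)), (continuous_of_discreteTopology (f := ιZ)).comp
          (f.1.continuous.comp continuous_subtype_val)⟩, fun σ τ ↦ by
        have h := f.2 (σ : Γ) (τ : Γ)
        change f.1 ((σ : Γ) * (τ : Γ)) = f.1 σ + X.ρ σ (f.1 τ) at h
        change ιZ (f.1 ((σ : Γ) * (τ : Γ))) = ιZ (f.1 σ) + (σ : Γ) • ιZ (f.1 τ)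
        rw [h, map_add, hXρ, hιeq]⟩
    obtain ⟨e, heA, he⟩ := hCG fN (fun τ ↦ hιA _)
    have he' : ∀ τ : Γ, τ ∈ N → ιZ (f.1 τ) = τ • e - e := fun τ hτ ↦ he ⟨τ, hτ⟩
    -- `f' = ιZ f − ∂e` vanishes on `N`; `x = f'(g) ∈ M₁`
    let f' : contOneCocycles (discreteTopRep Γ P) :=
      ⟨⟨fun σ ↦ ιZ (f.1 σ) - (σ • e - e), ((continuous_of_discreteTopology (f := ιZ)).comp f.1.continuous).sub
          ((continuous_smul_localPoints W E e).sub continuous_const)⟩, fun σ τ ↦ by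
        have h := f.2 σ τ
        change f.1 (σ * τ) = f.1 σ + X.ρ σ (f.1 τ) at h
        change ιZ (f.1 (σ * τ)) - ((σ * τ) • e - e) = (ιZ (f.1 σ) - (σ • e - e)) + σ • (ιZ (f.1 τ) - (τ • e - e))
        rw [h, map_add, hXρ, hιeq, mul_smul, smul_sub σ, smul_sub σ]
        abel⟩
    have hf' : ∀ σ : Γ, f'.1 σ = ιZ (f.1 σ) - (σ • e - e) := fun _ ↦ rfl
    have hf'N : ∀ τ ∈ N, f'.1 τ = 0 := fun τ hτ ↦ by rw [hf', he' τ hτ, sub_self]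
    have hf'A : ∀ σ : Γ, f'.1 σ ∈ A₁ := fun σ ↦ A₁.sub_mem (hιA _) (A₁.sub_mem (hstab _ _ heA) heA)
    set x : P := f'.1 g with hx_def
    have hxA : x ∈ A₁ := hf'A g
    have hxfix : ∀ h ∈ N, h • x = x := by
      intro h hh
      -- `f'(h g) = f'(h) + h f'(g) = h x` and `f'(h g) = f'(g (g⁻¹ h g)) = f'(g) + g f'(g⁻¹ h g) = x`
      have hmem : g⁻¹ * h * g ∈ N := by
        have := Subgroup.Normal.conj_mem inferInstance h hh g⁻¹
        rwa [inv_inv] at this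
      have h1 := f'.2 h g
      change f'.1 (h * g) = f'.1 h + h • f'.1 g at h1
      have h2 := f'.2 g (g⁻¹ * h * g)
      change f'.1 (g * (g⁻¹ * h * g)) = f'.1 g + g • f'.1 (g⁻¹ * h * g) at h2
      rw [hf'N _ hmem, smul_zero, add_zero, show g * (g⁻¹ * h * g) = h * g by group] at h2
      rw [h2, hf'N h hh, zero_add] at h1
      exact h1.symm
    have hxM : x ∈ M₁ := (hM₁ x).mpr ⟨hxA, hxfix⟩
    -- `p^k x = g y₀ − y₀` with `y₀ = −p^k e ∈ M₁`
    have hy₀fix : ∀ h ∈ N, h • (p ^ k • e) = p ^ k • e := fun h hh ↦ by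
      rw [smul_comm, ← sub_eq_zero, ← smul_sub, ← he' h hh, hιp]
    have hy₀M : -(p ^ k • e) ∈ M₁ := M₁.neg_mem ((hM₁ _).mpr ⟨AddSubgroup.nsmul_mem _ heA _, hy₀fix⟩)
    have hrelx : p ^ k • x = g • (-(p ^ k • e)) - (-(p ^ k • e)) := by
      rw [hx_def, hf', smul_sub, hιp, zero_sub, smul_sub (p ^ k), smul_comm (p ^ k) g e, smul_neg]
      abel
    have hc₀ : p ^ k • (QuotientAddGroup.mk ⟨x, hxM⟩ : M₁ ⧸ D₁.range) = 0 := by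
      rw [← QuotientAddGroup.mk_nsmul, QuotientAddGroup.eq_zero_iff]
      refine ⟨⟨-(p ^ k • e), hy₀M⟩, Subtype.ext ?_⟩
      rw [hD₁, AddSubgroup.coe_nsmul]
      exact hrelx.symm
    let c₀ : {c : M₁ ⧸ D₁.range // p ^ k • c = 0} := ⟨_, hc₀⟩
    refine ⟨c₀, ?_⟩
    -- `xr c₀ = x + (g m − m)` for some `m ∈ M₁`
    have hxrc : (QuotientAddGroup.mk (xr c₀) : M₁ ⧸ D₁.range) = QuotientAddGroup.mk ⟨x, hxM⟩ := hxr c₀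
    rw [QuotientAddGroup.eq_iff_sub_mem] at hxrc
    obtain ⟨m, hm⟩ := hxrc
    have hmval : (xr c₀ : P) = x + (g • (m : P) - m) := by
      have h := congrArg (fun z : M₁ ↦ (z : P)) hm
      simp only [hD₁, AddSubgroup.coe_sub] at h
      rw [h]; abel
    -- the coboundary of `m` and the comparison `cc c₀ = f' + ∂m`
    let dm : contOneCocycles (discreteTopRep Γ P) :=
      ⟨⟨fun σ ↦ σ • (m : P) - m, (continuous_smul_localPoints W E _).sub continuous_const⟩, fun σ τ ↦ by
        change (σ * τ) • (m : P) - m = (σ • (m : P) - m) + σ • (τ • (m : P) - m)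
        rw [mul_smul, smul_sub]; abel⟩
    have hdm : ∀ σ : Γ, dm.1 σ = σ • (m : P) - m := fun _ ↦ rfl
    have hccf : ∀ σ : Γ, (cc c₀).1 σ = f'.1 σ + (σ • (m : P) - m) := by
      intro σ
      have h0 := contOneCocycles_eq_zero_of_apply_eq_zero E κE hγ (cc c₀ - f' - dm) (fun τ hτ ↦ by
          rw [Submodule.coe_sub, Submodule.coe_sub, ContinuousMap.sub_apply, ContinuousMap.sub_apply, hcc0 c₀ τ hτ,
            hf'N τ hτ, hdm, hM₁i m τ hτ]
          simp only [sub_self])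
        (by
          rw [Submodule.coe_sub, Submodule.coe_sub, ContinuousMap.sub_apply, ContinuousMap.sub_apply, hccγ c₀,
            hmval, hdm, ← hx_def]
          abel) σ
      rw [Submodule.coe_sub, Submodule.coe_sub, ContinuousMap.sub_apply, ContinuousMap.sub_apply, hdm, sub_sub,
        sub_eq_zero] at h0
      exact h0
    -- `ιZ (χ σ) − ιZ (f σ) = σ t − t`, `t = m − e − ỹ`
    set t : P := (m : P) - e - rt (yr c₀ : P) (hM₁A (yr c₀)) with ht_def
    have htA : t ∈ A₁ := A₁.sub_mem (A₁.sub_mem (hM₁A m) heA) (hrtA _ _)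
    have hdiff : ∀ σ : Γ, ιZ ((chi c₀ - f).1 σ) = σ • t - t := by
      intro σ
      rw [Submodule.coe_sub, ContinuousMap.sub_apply, map_sub, hchi_apply, hccf, hf', ht_def]
      simp only [smul_sub]
      abel
    -- `p^k t ∈ A₀`
    have hpt : ∀ σ : Γ, σ • (p ^ k • t) = p ^ k • t := fun σ ↦ by
      have h := hιp ((chi c₀ - f).1 σ)
      rw [hdiff, smul_sub, smul_comm] at h
      exact sub_eq_zero.mp h
    let b : A₀ := ⟨p ^ k • t, (hA₀ _).mpr ⟨AddSubgroup.nsmul_mem _ htA _, hpt⟩⟩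
    have hcl : oneCocycleClass X (chi c₀ - f) = kum b := by
      rw [hkum]
      exact hindep _ _ t (rt b (hA₀A b)) htA (hrtA _ _) (by rw [hrt]) hdiff (hkc b)
    change (QuotientAddGroup.mk (oneCocycleClass X (chi c₀)) : discreteH1 Γ Z ⧸ kum.range) =
      QuotientAddGroup.mk (oneCocycleClass X f)
    rw [QuotientAddGroup.eq_iff_sub_mem, ← oneCocycleClass_sub, hcl]
    exact ⟨b, rfl⟩
  -- counting
  have h1 : Nat.card {c : M₁ ⧸ D₁.range // p ^ k • c = 0} = Nat.card (discreteH1 Γ Z ⧸ kum.range) :=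
    Nat.card_congr (Equiv.ofBijective Φ ⟨hΦ, hΦsurj⟩)
  have h2 : Nat.card (discreteH1 Γ Z) = Nat.card (discreteH1 Γ Z ⧸ kum.range) * Nat.card kum.range :=
    AddSubgroup.card_eq_card_quotient_mul_card_addSubgroup _
  refine ⟨Finite.of_injective Φ hΦ, ?_, ?_⟩
  · rw [← hker]
    exact Finite.of_equiv _ (QuotientAddGroup.quotientKerEquivRange kum).toEquiv.symm
  · rw [h2, hcardK, h1]

end Summit.BirchSwinnertonDyer.BirchSwinnertonDyer.Theorems.InputsGreenbergLemma34

end
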